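import Summits.AtomisticToContinuum.BoseEinsteinCondensation.Theorems.BECCellInformationOneBodyEntropyBoundWithinCellFisherLSIHelpers
import Summits.AtomisticToContinuum.BoseEinsteinCondensation.Theorems.BECCellInformationEntropicZeroMode

/-!
# Crux `OneBodyEntropyBound` (stmt-AtomisticToContinuum-13440), line `registered`:
# stub `stub_fibreCaging` — the one-body caging bound applied fibrewise

Support file (`--supports stmt-AtomisticToContinuum-13440`, registered helper stub `stub_fibreCaging` of the
lead's stub `stub_denseCellBound`). Given the ONE-BODY CAGING BOUND (hypothesis; the neighbouring stub
`stub_cagingBound`): `β ∫_{⋃_{j∈S} B(Y j, R)} |φ|² ≤ ∫_T (∑ₖ |∂ₖφ|² + (∑_{j∈S} v(|x − Y j|)) |φ|²)` for every `C¹`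
compactly supported one-body `φ`, every finite scatterer configuration and every measurable
`T ⊇ ⋃_{j∈S} B(Y j, 7R)`, we bound, for an `(n+1)`-boson Dirichlet trial state `Ψ`, the probability that
particle `0` lies in a measurable set `A` together with another particle of `A` within distance `R`, by the
kinetic + interaction share of particle `0` on `T ⊇ A + B(0, 7R)`:

`β · P(x₀ ∈ A, ∃ j ≥ 1 : x_j ∈ A, |x₀ − x_j| < R) ≤ ∫ 1_T(x₀) (|∇₀Ψ|² + (∑_{j≥1} v(|x₀ − x_j|)) |Ψ|²) dX`.

Proof (namespace `FibreCaging`): Tonelli with the first particle innermost (`lintegral_config_succ`); for a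
frozen tail `Y = (x₁, …, x_n)` the slice `φ_Y = Ψ(· :: Y)` is `C¹` (`contDiff_vecCons_slice`) with compact
support (`EntropicZeroMode.hasCompactSupport_slice`), its gradient is the partial gradient of particle `0`
(`gradSqC_vecCons_eq_partialGradSq`), and the caging bound with scatterers `Y` and `S = {j | Y j ∈ A}`
dominates the fibre of the left side (the event is inside `⋃_{j∈S} B(Y j, R)`) by the fibre of the right
side (`∑_{j∈S} ≤ ∑_j`). Elementary; `[folklore]` throughout. No new definitions.
-/

noncomputable section

namespace Summit.AtomisticToContinuum.BoseEinsteinCondensation.Cruxes.OneBodyEntropyBound.Birth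

open MeasureTheory Set Filter
open scoped ENNReal NNReal
open Literature.MathematicalPhysics.QuantumManyBody.BoseGas
open Summit.AtomisticToContinuum.BoseEinsteinCondensation.Theorems

namespace FibreCaging

variable {n : ℕ} {L : ℝ}

/-! ### Measurability of the two integrands -/

/-- The event "particle `0` in `A` with an `A`-neighbour within distance `R`" is measurable. [folklore] -/
theorem measurableSet_event {A : Set Space} (hA : MeasurableSet A) (R : ℝ) :
    MeasurableSet {X : Config (n + 1) | X 0 ∈ A ∧ ∃ j : Fin n, X j.succ ∈ A ∧ dist (X 0) (X j.succ) < R} := by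
  have h0 : MeasurableSet {X : Config (n + 1) | X 0 ∈ A} := measurable_pi_apply 0 hA
  have hj : ∀ j : Fin n,
      MeasurableSet {X : Config (n + 1) | X j.succ ∈ A ∧ dist (X 0) (X j.succ) < R} := fun j =>
    (measurable_pi_apply j.succ hA).inter
      (measurableSet_lt ((measurable_pi_apply 0).dist (measurable_pi_apply j.succ)) measurable_const)
  have he : {X : Config (n + 1) | X 0 ∈ A ∧ ∃ j : Fin n, X j.succ ∈ A ∧ dist (X 0) (X j.succ) < R} =
      {X : Config (n + 1) | X 0 ∈ A} ∩ ⋃ j : Fin n,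
        {X : Config (n + 1) | X j.succ ∈ A ∧ dist (X 0) (X j.succ) < R} := by
    ext X
    simp
  rw [he]
  exact h0.inter (MeasurableSet.iUnion hj)

/-- `X ↦ |Ψ(X)|²` is measurable (in `[0, ∞]`). [folklore] -/
theorem measurable_ennnormSq (Ψ : TrialState (n + 1) L) :
    Measurable fun X : Config (n + 1) => (‖Ψ.ψ X‖₊ : ℝ≥0∞) ^ 2 :=
  (Ψ.contDiff.continuous.measurable.nnnorm.coe_nnreal_ennreal).pow_const 2

/-- Measurability of the left integrand `1_E · |Ψ|²`. [folklore] -/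
theorem measurable_lhs (Ψ : TrialState (n + 1) L) {A : Set Space} (hA : MeasurableSet A) (R : ℝ) :
    Measurable fun X : Config (n + 1) =>
      {X : Config (n + 1) | X 0 ∈ A ∧ ∃ j : Fin n, X j.succ ∈ A ∧ dist (X 0) (X j.succ) < R}.indicator
        (fun _ => (1 : ℝ≥0∞)) X * (‖Ψ.ψ X‖₊ : ℝ≥0∞) ^ 2 :=
  (measurable_const.indicator (measurableSet_event hA R)).mul (measurable_ennnormSq Ψ)

/-- Measurability of the right integrand `1_T(x₀) (|∇₀Ψ|² + V₀ |Ψ|²)`. [folklore] -/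
theorem measurable_rhs {v : ℝ → ℝ≥0∞} (hv : Measurable v) (Ψ : TrialState (n + 1) L) {T : Set Space}
    (hT : MeasurableSet T) :
    Measurable fun X : Config (n + 1) => T.indicator (fun _ => (1 : ℝ≥0∞)) (X 0) *
      (partialGradSq 0 Ψ.ψ X + (∑ j : Fin n, v (dist (X 0) (X j.succ))) * (‖Ψ.ψ X‖₊ : ℝ≥0∞) ^ 2) :=
  ((measurable_const.indicator hT).comp (measurable_pi_apply 0)).mul
    ((measurable_partialGradSq 0 Ψ.ψ).add
      ((Finset.measurable_sum _ fun j _ =>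
        hv.comp ((measurable_pi_apply 0).dist (measurable_pi_apply j.succ))).mul (measurable_ennnormSq Ψ)))

/-- **The fibre inequality.** For a frozen tail `Y`, the caging bound for the slice `φ_Y = Ψ(· :: Y)` with
scatterers `Y` and `S = {j | Y j ∈ A}` dominates the fibre of the event by the fibre of the share. [folklore] -/
theorem fibre_le {v : ℝ → ℝ≥0∞} {R β : ℝ}
    (hcage : ∀ (m : ℕ) (Y : Fin m → Space) (S : Finset (Fin m)) (T : Set Space), MeasurableSet T →
      (∀ j ∈ S, Metric.ball (Y j) (7 * R) ⊆ T) →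
      ∀ φ : Space → ℂ, ContDiff ℝ 1 φ → HasCompactSupport φ →
        ENNReal.ofReal β * ∫⁻ x in ⋃ j ∈ S, Metric.ball (Y j) R, (‖φ x‖₊ : ℝ≥0∞) ^ 2 ≤
          ∫⁻ x in T, ((∑ k : Fin 3, (‖fderiv ℝ φ x (EuclideanSpace.single k (1 : ℝ))‖₊ : ℝ≥0∞) ^ 2) +
            (∑ j ∈ S, v (dist x (Y j))) * (‖φ x‖₊ : ℝ≥0∞) ^ 2))
    (Ψ : TrialState (n + 1) L) {A T : Set Space} (hT : MeasurableSet T)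
    (hAT : ∀ y ∈ A, Metric.ball y (7 * R) ⊆ T) (Y : Config n) :
    ENNReal.ofReal β * ∫⁻ x : Space,
        {X : Config (n + 1) | X 0 ∈ A ∧ ∃ j : Fin n, X j.succ ∈ A ∧ dist (X 0) (X j.succ) < R}.indicator
          (fun _ => (1 : ℝ≥0∞)) (Matrix.vecCons x Y) * (‖Ψ.ψ (Matrix.vecCons x Y)‖₊ : ℝ≥0∞) ^ 2 ≤
      ∫⁻ x : Space, T.indicator (fun _ => (1 : ℝ≥0∞)) ((Matrix.vecCons x Y : Config (n + 1)) 0) *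
        (partialGradSq 0 Ψ.ψ (Matrix.vecCons x Y) +
          (∑ j : Fin n, v (dist ((Matrix.vecCons x Y : Config (n + 1)) 0)
            ((Matrix.vecCons x Y : Config (n + 1)) j.succ))) *
            (‖Ψ.ψ (Matrix.vecCons x Y)‖₊ : ℝ≥0∞) ^ 2) := by
  classical
  set φ : Space → ℂ := fun x => Ψ.ψ (Matrix.vecCons x Y) with hφdef
  have hφ : ContDiff ℝ 1 φ := contDiff_vecCons_slice Ψ.contDiff Y
  have hφc : HasCompactSupport φ := EntropicZeroMode.hasCompactSupport_slice Ψ Y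
  set S : Finset (Fin n) := Finset.univ.filter fun j => Y j ∈ A with hSdef
  have hST : ∀ j ∈ S, Metric.ball (Y j) (7 * R) ⊆ T := fun j hj =>
    hAT _ (Finset.mem_filter.1 hj).2
  have key := hcage n Y S T hT hST φ hφ hφc
  have hU : MeasurableSet (⋃ j ∈ S, Metric.ball (Y j) R) :=
    MeasurableSet.biUnion S.countable_toSet fun j _ => Metric.isOpen_ball.measurableSet
  -- left side: the event fibre lies inside `⋃_{j ∈ S} B(Y j, R)`
  have hleft : ∫⁻ x : Space,
      {X : Config (n + 1) | X 0 ∈ A ∧ ∃ j : Fin n, X j.succ ∈ A ∧ dist (X 0) (X j.succ) < R}.indicator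
        (fun _ => (1 : ℝ≥0∞)) (Matrix.vecCons x Y) * (‖Ψ.ψ (Matrix.vecCons x Y)‖₊ : ℝ≥0∞) ^ 2 ≤
      ∫⁻ x in ⋃ j ∈ S, Metric.ball (Y j) R, (‖φ x‖₊ : ℝ≥0∞) ^ 2 := by
    rw [← lintegral_indicator hU]
    refine lintegral_mono fun x => ?_
    by_cases hx : (Matrix.vecCons x Y : Config (n + 1)) ∈
        {X : Config (n + 1) | X 0 ∈ A ∧ ∃ j : Fin n, X j.succ ∈ A ∧ dist (X 0) (X j.succ) < R}
    · have hx' : x ∈ ⋃ j ∈ S, Metric.ball (Y j) R := by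
        obtain ⟨-, j, hjA, hjR⟩ := hx
        simp only [Matrix.cons_val_zero, Matrix.cons_val_succ] at hjA hjR
        exact Set.mem_iUnion₂.2 ⟨j, Finset.mem_filter.2 ⟨Finset.mem_univ _, hjA⟩, Metric.mem_ball.2 hjR⟩
      rw [Set.indicator_of_mem hx, Set.indicator_of_mem hx', one_mul]
    · rw [Set.indicator_of_notMem hx, zero_mul]
      exact bot_le
  -- right side: the set integral over `T` is below the fibre of the share
  have hright : ∫⁻ x in T, ((∑ k : Fin 3, (‖fderiv ℝ φ x (EuclideanSpace.single k (1 : ℝ))‖₊ : ℝ≥0∞) ^ 2) +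
        (∑ j ∈ S, v (dist x (Y j))) * (‖φ x‖₊ : ℝ≥0∞) ^ 2) ≤
      ∫⁻ x : Space, T.indicator (fun _ => (1 : ℝ≥0∞)) ((Matrix.vecCons x Y : Config (n + 1)) 0) *
        (partialGradSq 0 Ψ.ψ (Matrix.vecCons x Y) +
          (∑ j : Fin n, v (dist ((Matrix.vecCons x Y : Config (n + 1)) 0)
            ((Matrix.vecCons x Y : Config (n + 1)) j.succ))) *
            (‖Ψ.ψ (Matrix.vecCons x Y)‖₊ : ℝ≥0∞) ^ 2) := by
    rw [← lintegral_indicator hT]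
    refine lintegral_mono fun x => ?_
    simp only [Matrix.cons_val_zero, Matrix.cons_val_succ]
    by_cases hx : x ∈ T
    · rw [Set.indicator_of_mem hx, Set.indicator_of_mem hx, one_mul]
      have hgrad : (∑ k : Fin 3, (‖fderiv ℝ φ x (EuclideanSpace.single k (1 : ℝ))‖₊ : ℝ≥0∞) ^ 2) =
          partialGradSq 0 Ψ.ψ (Matrix.vecCons x Y) :=
        gradSqC_vecCons_eq_partialGradSq Ψ.contDiff.differentiable_one x Y
      rw [hgrad]
      gcongr
      exact Finset.subset_univ _
    · rw [Set.indicator_of_notMem hx, Set.indicator_of_notMem hx, zero_mul]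
  calc ENNReal.ofReal β * ∫⁻ x : Space,
        {X : Config (n + 1) | X 0 ∈ A ∧ ∃ j : Fin n, X j.succ ∈ A ∧ dist (X 0) (X j.succ) < R}.indicator
          (fun _ => (1 : ℝ≥0∞)) (Matrix.vecCons x Y) * (‖Ψ.ψ (Matrix.vecCons x Y)‖₊ : ℝ≥0∞) ^ 2
      ≤ ENNReal.ofReal β * ∫⁻ x in ⋃ j ∈ S, Metric.ball (Y j) R, (‖φ x‖₊ : ℝ≥0∞) ^ 2 := by gcongr
    _ ≤ _ := key
    _ ≤ _ := hright

end FibreCaging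

/-- **Registered helper stub `stub_fibreCaging`** (for the lead's `stub_denseCellBound`): the one-body caging
bound (hypothesis) applied fibrewise — for an `(n+1)`-boson Dirichlet trial state, `β` times the probability
that particle `0` lies in `A` with another particle of `A` within distance `R` is at most the kinetic +
interaction share of particle `0` on any measurable `T ⊇ A + B(0, 7R)`. [folklore] -/
theorem stub_fibreCaging :
    ∀ (v : ℝ → ENNReal), Measurable v → ∀ (R β : ℝ), 0 < R → 0 < β →
      (∀ (m : ℕ) (Y : Fin m → EuclideanSpace ℝ (Fin 3)) (S : Finset (Fin m))
          (T : Set (EuclideanSpace ℝ (Fin 3))), MeasurableSet T →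
          (∀ j ∈ S, Metric.ball (Y j) (7 * R) ⊆ T) →
          ∀ φ : EuclideanSpace ℝ (Fin 3) → ℂ, ContDiff ℝ 1 φ → HasCompactSupport φ →
            ENNReal.ofReal β * ∫⁻ x in ⋃ j ∈ S, Metric.ball (Y j) R, (‖φ x‖₊ : ENNReal) ^ 2 ≤
              ∫⁻ x in T, ((∑ k : Fin 3, (‖fderiv ℝ φ x (EuclideanSpace.single k (1 : ℝ))‖₊ : ENNReal) ^ 2) +
                (∑ j ∈ S, v (dist x (Y j))) * (‖φ x‖₊ : ENNReal) ^ 2)) →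
      ∀ (n : ℕ) (L : ℝ) (Ψ : Literature.MathematicalPhysics.QuantumManyBody.BoseGas.TrialState (n + 1) L)
        (A T : Set (EuclideanSpace ℝ (Fin 3))), MeasurableSet A → MeasurableSet T →
        (∀ y ∈ A, Metric.ball y (7 * R) ⊆ T) →
        ENNReal.ofReal β * ∫⁻ X : Literature.MathematicalPhysics.QuantumManyBody.BoseGas.Config (n + 1),
            ({X : Literature.MathematicalPhysics.QuantumManyBody.BoseGas.Config (n + 1) |
                X 0 ∈ A ∧ ∃ j : Fin n, X j.succ ∈ A ∧ dist (X 0) (X j.succ) < R}).indicator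
              (fun _ => (1 : ENNReal)) X * (‖Ψ.ψ X‖₊ : ENNReal) ^ 2 ≤
          ∫⁻ X : Literature.MathematicalPhysics.QuantumManyBody.BoseGas.Config (n + 1),
            T.indicator (fun _ => (1 : ENNReal)) (X 0) *
              (Literature.MathematicalPhysics.QuantumManyBody.BoseGas.partialGradSq 0 Ψ.ψ X +
                (∑ j : Fin n, v (dist (X 0) (X j.succ))) * (‖Ψ.ψ X‖₊ : ENNReal) ^ 2) := by
  intro v hv R β _hR _hβ hcage n L Ψ A T hA hT hAT
  rw [lintegral_config_succ (FibreCaging.measurable_lhs Ψ hA R),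
    lintegral_config_succ (FibreCaging.measurable_rhs hv Ψ hT),
    ← lintegral_const_mul' _ _ ENNReal.ofReal_ne_top]
  exact lintegral_mono fun Y => FibreCaging.fibre_le hcage Ψ hT hAT Y

end Summit.AtomisticToContinuum.BoseEinsteinCondensation.Cruxes.OneBodyEntropyBound.Birth

end
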